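import Summits.ABC.IUTFork.Repair.RHLabelCutJ2Bridge
import Summits.ABC.IUTFork.Repair.RHLabelCutJ2K2
import Summits.ABC.IUTFork.Cor312ProvKRamifiedLabel
import HarnessLib

/-!
# R-H ROUND 1, ROW 1 «label-cut-j2» — TESTER k2/k3 re-run on the TYPED deciding declarations
# `RH.LabelCutJ2.HStarGenuine D t tq` / `RH.LabelCutJ2.HStar S P ρ qK` (abc-iut-rh-typ-1, p459899) ≡ `RH.LabelCutJ3.StarBelow D tq 2`
# (abc-iut-rh-typ-9, p459152; bridge p460843): the unramified-odd refutation family is VOID at the genuine bed (genuine face),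
# its region member BITES the lattice face on the honest bed, and row 1's own integer doors at `j₀ = 2`

PROOF-ONLY (0 definitions, 0 `Prop` facts; abc-iut cell, rung LADDER-ABC:A2.RESCUE.H; seat abc-iut-rh-tst-1 = R-H ROUND 1 PAIR n = 1
TESTER, gen 2; director-abc W13 (A) items k2/k3 «against the typer's decl the minute it lands»). Companion of this seat's
`Repair/RHLabelCutJ2K2.lean` (p458420: the row AS REGISTERED — scope «all bad places, all admissible l» — is bitten by the family at every
unramified odd datum, `K = ℚ_p`, `q̲ = p`, `j = 2`). THE TYPED DECLARATIONS UNDER TEST: the pair's typer abc-iut-rh-typ-1 filed (p459899 ✓)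
`Summit.ABC.IUTFork.Repair.RH.LabelCutJ2.HStarGenuine D t tq` — the I06⋆ data cells `t_{q,x} ∈ t_{Θ,j,x}·ℐ_x` at the labels `j ≤ 2` of the GENUINE
`K`-level datum `Cor312Prov.pilotDataOfK D K` of an arbitrary collection of initial Θ-data `D` ([IUTchI] Def. 3.1), its DECL OF RECORD — and the
lattice face `RH.LabelCutJ2.HStar S P ρ qK` (abc-iut-rp-h3's «I06⋆ below the cut» at the constant cut `2` on a `LatticeSituation`); pair 9's typer
abc-iut-rh-typ-9 filed the family `RH.LabelCutJ3.StarBelow D tq j₀` (p459152 ✓, «row 1 is `j₀ = 2`»), and typ-1's bridge (p460843 ✓) feeds both from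
the same integer door. §2's `starBelow_two_iff_hStarGenuine_pow` makes «one object» literal: `StarBelow D tq 2` IS `HStarGenuine D t tq` at the
power Θ-ideles `t_{j,x} = t_{q,x}^{j²}` (definitional). THIS FILE tests the genuine face (§1–§3, stated on `StarBelow D tq 2`) and the lattice face (§4).

FINDINGS (every clause a theorem below; tree facts consumed BY NAME, nothing re-derived):
* §1 k2 — THE STRATUM IS EMPTY AT THE BED (kernel, not «admissibility class»): every landed Negative lemma of the unramified-odd family
  (`CandInternal2Real.not_mem_jsq_smul_logShell_of_unramified`, `…of_root_lt` at `e = 1`, this seat's `RHLabelCutJ2K2.cellTwo_false_of_unramified`,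
  abc-iut-rh-typ-9's suggested route `RH.LabelCutJ3.cell_iff_of_tame` at `e = 1`) carries the hypothesis `e(K_w/ℚ_p) = 1` at a bad place. At
  `pilotDataOfK D K` every bad place has `e(K_w/ℚ_p) ≥ l ≥ 5` — abc-iut-C-cert-2's `Cor312Prov.l_le_absRamificationIdx_kOf_pilotDataOfK`
  (Cor312ProvKRamifiedLabel, on abc-iut-w5-d054's `l_le_ramificationIdx_int_of_over_VFbad`: [IUTchI] Def. 3.1 (c) `l ∤ ord_v(q_v)` with Ex. 3.2 (iv)
  `2l ∣ ord_w(q)`), so that hypothesis is REFUTED there: `absRamificationIdx_kOf_ne_one_of_mem_S`, `ramificationIdx_int_placeOf_ne_one_of_mem_S`,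
  landed `RHLabelCutJ3K2.not_exists_unramified_badPlace_pilotDataOfK` (abc-iut-rh-tst-9; cited, not restated). Hence the family MISSES the typed decl (k2 PASS-by-scope with a kernel certificate), exactly as it misses
  row 9's `HStar D tq` and row 15's `SlotReachWindow` at the bed (abc-iut-rh-tst-12, `RHSlotReachUnramified` §4, same lemma). The REGION members
  (`EvalHonestCeiling.i06_false_of_honest`, this seat's `labelTwo_shellOrbit_false_of_honest`) conclude `¬ HQShellOrbit …` / a hull-cell negation on
  an honest `LatticeSituation` bed — a different TYPE from the data cell `t_{q,w} ∈ t_{q,w}^{j²}·ℐ_{K_w}`; no tree implication `StarBelow → HQShellOrbit`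
  exists without the q-pin + RP-I05 sandwich (START-HERE (L1)), so they miss the typed decl by type.
* §2 ROW 1's DECIDING DECLARATION HAS ITS OWN DOORS (one-line instances of p459152 at `j₀ = 2`, realising q-idele `tq`):
  `starBelow_two_of_posDoor` (POS door `4·P_w + ⌈e_w/(p−2)⌉ ≤ e_w + P_w` at every bad place ⟹ `StarBelow D tq 2`; idele-hypothesis-free twin
  `starBelow_two_chosen_of_posDoor`), `not_starBelow_two_of_negDoor` (ONE bad place with `e_w ≥ p − 1` and the NEG door at `j = 2` ⟹ `¬ StarBelow D tq 2`;
  `l ≥ 5` makes the label `2` available, `InitialThetaData.five_le_l`), `not_starBelow_two_of_tame_lt` (ONE tame bad place, `e_w ≤ p − 2`, with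
  `e_w − 1 < 3·P_w` ⟹ `¬ StarBelow D tq 2`, by abc-iut-w5-d068's exact tame cell). So row 1 is GENUINELY TWO-SIDED at the bed (k1 territory: pooled
  63.6 %, lamSeven 256/256 per rh-num-1 — cited, not re-derived), and NOT decided by the unramified-odd family.
* §3 INTEGER ROWS BY `decide` for the k3 WINDOW-TABLE packets (HEX at `p = 7`: `e_w = l·e(v|7)`, `P_w = k·e(v|7)`): the `j = 2` frontier on the
  two smallest genuine local types `e_w = 11, 13` (POS `k ≤ 2` / `k ≤ 3`, OPEN between, NEG `k ≥ 8` / `k ≥ 9`), the G-HEX binding rows `k4-l23`,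
  `k12-l211-ev5` POS at `j = 2` (row 1 TRUE there), the `l = 5` strip (`e_w = 5` tame: POS only at `k = 1`; the deep NEG door is silent there, the tame
  iff decides), and the `p = 3` rider of p458420 in integer currency: `¬ PosDoor 3 e P 2` for every `e` and every `P ≥ 1` (`⌈e/(p−2)⌉ = e`: `κ⁻ ≡ 0`).
* §4 THE LATTICE FACE IS BITTEN BY THE REGION MEMBER (kernel): `RH.LabelCutJ2.HStar S P ρ qK` keeps the `j = 2` cell `ρ(qK) 2 v_ℚ ⊆ ⋃ₘ ρ(Ψₘ·𝓘) 2 v_ℚ`,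
  which is FALSE on the honest bed — q-pin, RP-I05b `HInd3Theta`, monotone log-volume, the (Ind3)-Θ-region admissible with exact `2²`-scaling and
  `qLocal 2 v_ℚ < 0` at ONE packet: `not_hStar_of_honest`, one line on p458420's `labelTwo_shellOrbit_false_of_honest` — exactly as the same member
  bit I06⋆ (`EvalHonestCeiling.i06_false_of_honest`); concordant with abc-iut-rh-typ-1's REPAIR CENSUS «honest-ceiling region kill = NOT repairable
  inside C1». So: genuine face MISSED by scope (§1), lattice face BITTEN on the honest bed (§4) — the two faces of ONE candidate answer k2 differently
  because the honest bed is a hypothesis on `(S, P, ρ)` that the genuine datum is not shown to carry (no tree lemma either way; recorded, not claimed).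
VERDICT WORDS are the lead's (ROUND1.tsv one writer). What this file certifies: k2T(genuine face `HStarGenuine` ≡ `StarBelow D tq 2`) = PASS-by-scope
(kernel); k2T(lattice face `HStar S P ρ qK`) = BITTEN on the honest bed (kernel); k2T(as registered) = BITTEN (p458420); the row's content at
the bed is the two-sided `j = 2` data cell, a WINDOW-LOCATOR in the label, whose sufficiency for S_H /
the Statement is NOT claimed here (abc-iut-rp-h1 `RHLabelCutGenuineFloor.explicitFloorMass_settingPrVolSharp_pos`: below-cut cells alone do not
open the Statement door).

HONEST SCOPE. Dedekind/Neukirch ramification arithmetic, one `p`-adic window lemma per door, `decide` on integers; nothing here asserts or refutes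
abc, takes a side on [IUTchIII] Cor. 3.12 or on any author; row 1 is a HYPOTHESIS under test; typed ≠ proved; tested ≠ endorsed.
[cite: Mochizuki2012, IUTchI Def. 3.1 (b),(c) pp. 61–62, Ex. 3.2 (iv) p. 71; IUTchIV Prop. 1.2 (i) p. 10] [cite: MochizukiAbsTopIII2015, Def 5.4 (iii) p. 126]
[cite: NeukirchANT1999, Ch. II Prop. (6.8)] [claim: Mochizuki2012, status: disputed] for every IUT locution. Axioms: standard.
-/

noncomputable section

open Set Metric Function NumberField IsDedekindDomain
open scoped Pointwise

namespace Summit.ABC.IUTFork.Repair.RHLabelCutJ2Genuine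

open Literature.AnabelianGeometry.AbsoluteAnabelian Literature.IUT.LogThetaLattice Literature.IUT.LogVolume
  Literature.IUT.HodgeTheaters Literature.NumberTheory.NumberFields Literature.NumberTheory.GaloisRepresentations.Ultrametric
open Summit.ABC.IUTFork.Thm311 Summit.ABC.IUTFork.Thm311.Real Summit.ABC.IUTFork.Cor312 Summit.ABC.IUTFork.Cor312.Setting
  Summit.ABC.IUTFork.Cor312Vol Summit.ABC.IUTFork.Cor312Prov Summit.ABC.IUTFork.Repair.CandInternal2Real
  Summit.ABC.IUTFork.Repair.CandInternal2RealLabels Summit.ABC.IUTFork.Repair.RH.LabelCutJ3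

section Genuine

variable {F K Fbar : Type} [Field F] [NumberField F] [Field K] [NumberField K] [Algebra F K] [Field Fbar]
  [Algebra F Fbar] [Algebra K Fbar] {E : WeierstrassCurve F} [E.IsElliptic] {l : ℕ} {Pb : BadPlacePredicates K}
  (D : InitialThetaData F K Fbar E l Pb)

/-! ## §1. k2 at the typed decl: the unramified-odd stratum is EMPTY at the genuine bed -/

/-- **`e(K_w/ℚ_p) ≥ 5` at every bad place of `pilotDataOfK D K`** (`l ≤ e(K_w/ℚ_p)` is abc-iut-C-cert-2's
`Cor312Prov.l_le_absRamificationIdx_kOf_pilotDataOfK`; `5 ≤ l` is [IUTchI] Def. 3.1 (c) as typed). [cite: Mochizuki2012, IUTchI Def. 3.1 (c) p. 62, Ex. 3.2 (iv) p. 71] -/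
theorem five_le_absRamificationIdx_kOf_of_mem_S (pp : Nat.Primes) (w : (thetaIndex (pilotDataOfK D K)).Fibre (.inr pp))
    (hw : haveI : Fact (pp : ℕ).Prime := ⟨pp.2⟩; placeOf (pilotDataOfK D K) pp.1 w ∈ (pilotDataOfK D K).S) :
    haveI : Fact (pp : ℕ).Prime := ⟨pp.2⟩
    5 ≤ absRamificationIdx (pp : ℕ) (kOf (pilotDataOfK D K) pp.1 w) := by
  haveI : Fact (pp : ℕ).Prime := ⟨pp.2⟩
  exact D.five_le_l.trans (l_le_absRamificationIdx_kOf_pilotDataOfK D pp w hw)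

/-- **k2T KERNEL CERTIFICATE: the unramified-odd family's hypothesis `e(K_w/ℚ_p) = 1` is REFUTED at every bad place of the genuine bed.**
Every landed member of the family (`CandInternal2Real.not_mem_jsq_smul_logShell_of_unramified`, `RHLabelCutJ2K2.cellTwo_false_of_unramified`, …)
needs `absRamificationIdx p K_w = 1`; at `K_w = kOf (pilotDataOfK D K) p w`, `w` bad, this is false. So the family MISSES `StarBelow D tq 2`.
[cite: Mochizuki2012, IUTchI Def. 3.1 (c) p. 62, Ex. 3.2 (iv) p. 71] -/
theorem absRamificationIdx_kOf_ne_one_of_mem_S (pp : Nat.Primes) (w : (thetaIndex (pilotDataOfK D K)).Fibre (.inr pp))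
    (hw : haveI : Fact (pp : ℕ).Prime := ⟨pp.2⟩; placeOf (pilotDataOfK D K) pp.1 w ∈ (pilotDataOfK D K).S) :
    haveI : Fact (pp : ℕ).Prime := ⟨pp.2⟩
    absRamificationIdx (pp : ℕ) (kOf (pilotDataOfK D K) pp.1 w) ≠ 1 := by
  haveI : Fact (pp : ℕ).Prime := ⟨pp.2⟩
  have h5 := five_le_absRamificationIdx_kOf_of_mem_S D pp w hw
  omega

/-- The same for Mathlib's `e(w|p)` of the place itself (the `hram : 𝔭_w.ramificationIdx ℤ = e` binder of the tame iff
`RH.LabelCutJ3.cell_iff_of_tame` — the route «tame at `e = 1`» is void at the bed too). [cite: Mochizuki2012, IUTchI Def. 3.1 (c) p. 62] -/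
theorem ramificationIdx_int_placeOf_ne_one_of_mem_S (pp : Nat.Primes) (w : (thetaIndex (pilotDataOfK D K)).Fibre (.inr pp))
    (hw : haveI : Fact (pp : ℕ).Prime := ⟨pp.2⟩; placeOf (pilotDataOfK D K) pp.1 w ∈ (pilotDataOfK D K).S) :
    haveI : Fact (pp : ℕ).Prime := ⟨pp.2⟩
    (placeOf (pilotDataOfK D K) pp.1 w).asIdeal.ramificationIdx ℤ ≠ 1 := by
  haveI : Fact (pp : ℕ).Prime := ⟨pp.2⟩
  have h5 := D.five_le_l
  have hl := l_le_ramificationIdx_int_of_over_VFbad D (placeOf (pilotDataOfK D K) pp.1 w)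
    ((mem_pilotDataOfK_S_iff D K _).mp hw)
  omega

-- NO bad place of the genuine bed lies on the unramified stratum (existential form of the k2T certificate): ALREADY LANDED as
-- `Summit.ABC.IUTFork.Repair.RHLabelCutJ3K2.not_exists_unramified_badPlace_pilotDataOfK` (abc-iut-rh-tst-9, Repair/RHLabelCutJ3K2.lean) —
-- cited BY NAME, not restated (gate dedup.landed at proxy filing; the copy `not_exists_unramified_bad_place` was dropped, nothing else changed).

/-! ## §2. Row 1's deciding declaration `StarBelow D tq 2` and its integer doors at the genuine bed -/

variable
  (tq : ∀ (pp : Nat.Primes) (x : (thetaIndex (pilotDataOfK D K)).Fibre (.inr pp)),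
    haveI : Fact (pp : ℕ).Prime := ⟨pp.2⟩; kOf (pilotDataOfK D K) pp.1 x)
  (htq0 : ∀ pp x, tq pp x ≠ 0)
  (htq : ∀ (pp : Nat.Primes) (x : (thetaIndex (pilotDataOfK D K)).Fibre (.inr pp)),
    haveI : Fact (pp : ℕ).Prime := ⟨pp.2⟩
    Real.log ‖tq pp x‖ = -((pilotDataOfK D K).qPilot (placeOf (pilotDataOfK D K) pp.1 x)) *
      logNorm K (placeOf (pilotDataOfK D K) pp.1 x) / localDegree K (placeOf (pilotDataOfK D K) pp.1 x))

/-- The label `j = 2` is available at the genuine datum: `2 ≤ l⋆ = (l − 1)/2` since `l ≥ 5`. [cite: Mochizuki2012, IUTchI Def. 3.1 (c) p. 61] -/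
theorem two_le_lstar : 2 ≤ (pilotDataOfK D K).lstar := by
  rw [lstar_eq]
  have h5 := D.five_le_l
  omega

/-- **«ONE OBJECT», LITERALLY**: abc-iut-rh-typ-9's one-element typing `StarBelow D tq 2` IS abc-iut-rh-typ-1's decl of record
`HStarGenuine D t tq` at the power Θ-ideles `t_{j,x} := t_{q,x}^{j²}` — definitional unfolding, no hypothesis on `tq`. Hence every k2/k3 clause of
§1–§3 below, stated on `StarBelow D tq 2`, is a clause on `HStarGenuine D (t_q^{j²}) tq` verbatim. [claim: Mochizuki2012, status: disputed] -/
theorem starBelow_two_iff_hStarGenuine_pow :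
    StarBelow D tq 2 ↔
      RH.LabelCutJ2.HStarGenuine D
        (fun pp i x => haveI : Fact (pp : ℕ).Prime := ⟨pp.2⟩; tq pp x ^ (((i : ℕ) + 1) ^ 2)) tq :=
  ⟨fun h pp i x hx hi => h pp i x hx hi, fun h pp i x hx hi => h pp i x hx hi⟩

include htq0 htq in
/-- **k1 POS VERDICT FOR ROW 1 AT THE TYPED DECL**: the integer POS door at `j = 2` (`4·P_w + ⌈e_w/(p−2)⌉ ≤ e_w + P_w`, i.e. the row's
«`h(w,2) = 3H/(2l) ≤ κ⁻(w)`») at EVERY bad place ⟹ `StarBelow D tq 2` (abc-iut-rh-typ-9's `cell_of_posDoor` + `posDoor_anti`; `p ≠ 2` at bad places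
by [IUTchI] Def. 3.1 (b)). [cite: Mochizuki2012, IUTchI Def. 3.1 (b) p. 61, Ex. 3.2 (iv) p. 71; IUTchIV Prop. 1.2 (i) p. 10] [claim: Mochizuki2012, status: disputed] -/
theorem starBelow_two_of_posDoor
    (hdoor : ∀ (pp : Nat.Primes) (w : (thetaIndex (pilotDataOfK D K)).Fibre (.inr pp)),
      haveI : Fact (pp : ℕ).Prime := ⟨pp.2⟩
      placeOf (pilotDataOfK D K) pp.1 w ∈ (pilotDataOfK D K).S →
        ∃ P : ℕ, (pilotDataOfK D K).qPilot (placeOf (pilotDataOfK D K) pp.1 w) = P ∧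
          PosDoor (pp : ℕ) (absRamificationIdx (pp : ℕ) (kOf (pilotDataOfK D K) pp.1 w)) P 2) :
    StarBelow D tq 2 := by
  intro pp i w hw hi
  haveI hF : Fact (pp : ℕ).Prime := ⟨pp.2⟩
  obtain ⟨P, hP, hd⟩ := hdoor pp w hw
  have hp2 : (pp : ℕ) ≠ 2 := (ne_two_and_ne_l_of_placeOf_mem_S_pilotDataOfK D pp w hw).1
  exact cell_of_posDoor D tq htq0 htq pp w hp2 hP rfl (posDoor_anti hi hd)

include htq0 htq in
/-- **k1 NEG VERDICT FOR ROW 1 AT THE TYPED DECL (deep/boundary place)**: ONE bad place `w ∣ p` with `e_w ≥ p − 1` where the integer NEG door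
holds at `j = 2` (`e_w·(⌊log_p(e_w/(p−1))⌋ + 2) + P_w ≤ 4·P_w`) ⟹ `¬ StarBelow D tq 2` (abc-iut-rh-typ-9's `not_cell_of_negDoor`; the label `2`
exists since `l ≥ 5`). [cite: Mochizuki2012, IUTchI Def. 3.1 (b),(c) p. 61; IUTchIV Prop. 1.2 (i) p. 10] [claim: Mochizuki2012, status: disputed] -/
theorem not_starBelow_two_of_negDoor (pp : Nat.Primes) (w : (thetaIndex (pilotDataOfK D K)).Fibre (.inr pp))
    (hw : haveI : Fact (pp : ℕ).Prime := ⟨pp.2⟩; placeOf (pilotDataOfK D K) pp.1 w ∈ (pilotDataOfK D K).S) {P : ℕ}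
    (hP : haveI : Fact (pp : ℕ).Prime := ⟨pp.2⟩; (pilotDataOfK D K).qPilot (placeOf (pilotDataOfK D K) pp.1 w) = P)
    (hpe : haveI : Fact (pp : ℕ).Prime := ⟨pp.2⟩; (pp : ℕ) - 1 ≤ absRamificationIdx (pp : ℕ) (kOf (pilotDataOfK D K) pp.1 w))
    (hdoor : haveI : Fact (pp : ℕ).Prime := ⟨pp.2⟩; NegDoor (pp : ℕ) (absRamificationIdx (pp : ℕ) (kOf (pilotDataOfK D K) pp.1 w)) P 2) :
    ¬ StarBelow D tq 2 := by
  haveI hF : Fact (pp : ℕ).Prime := ⟨pp.2⟩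
  intro h
  have hp2 : (pp : ℕ) ≠ 2 := (ne_two_and_ne_l_of_placeOf_mem_S_pilotDataOfK D pp w hw).1
  have hcell := h pp ⟨1, two_le_lstar D⟩ w hw le_rfl
  exact not_cell_of_negDoor D tq htq0 htq pp w hp2 hP rfl hpe hdoor hcell

include htq0 htq in
/-- **k1 NEG VERDICT FOR ROW 1 AT THE TYPED DECL (tame place)**: ONE tame bad place (`p > 2`, `e_w ≤ p − 2`) with `e_w − 1 < 3·P_w` ⟹
`¬ StarBelow D tq 2` — by abc-iut-w5-d068's EXACT tame cell `t_{q,w} ∈ t_{q,w}^{j²}·ℐ_{K_w} ⟺ (j²−1)·P_w ≤ e_w − 1` (`RH.LabelCutJ3.cell_iff_of_tame`).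
(E.g. the HEX `l = 5` strip at `e(v|7) = 1`: `e_w = 5`, `P_w = k`: row 1 fails for every `k ≥ 2`.) [cite: DupuyHilado2025, §3.4]
[cite: MochizukiAbsTopIII2015, Def 5.4 (iii) p. 126] [claim: Mochizuki2012, status: disputed] -/
theorem not_starBelow_two_of_tame_lt (pp : Nat.Primes) (w : (thetaIndex (pilotDataOfK D K)).Fibre (.inr pp))
    (hw : haveI : Fact (pp : ℕ).Prime := ⟨pp.2⟩; placeOf (pilotDataOfK D K) pp.1 w ∈ (pilotDataOfK D K).S)
    (hp3 : 2 < (pp : ℕ)) {e : ℕ} (hep : e ≤ (pp : ℕ) - 2)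
    (hram : haveI : Fact (pp : ℕ).Prime := ⟨pp.2⟩; (placeOf (pilotDataOfK D K) pp.1 w).asIdeal.ramificationIdx ℤ = e) {P : ℕ}
    (hP : haveI : Fact (pp : ℕ).Prime := ⟨pp.2⟩; (pilotDataOfK D K).qPilot (placeOf (pilotDataOfK D K) pp.1 w) = P)
    (hlt : (e : ℤ) - 1 < 3 * (P : ℤ)) :
    ¬ StarBelow D tq 2 := by
  haveI hF : Fact (pp : ℕ).Prime := ⟨pp.2⟩
  intro h
  have hcell : tq pp w ∈ tq pp w ^ (2 ^ 2) • logShell (PadicLogOnUnits.ofUnitLog (pp : ℕ) (kOf (pilotDataOfK D K) pp.1 w)) :=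
    h pp ⟨1, two_le_lstar D⟩ w hw le_rfl
  have hle := (cell_iff_of_tame D tq htq0 htq pp w hp3 hep hram hP 2).mp hcell
  push_cast at hle
  linarith

omit tq in
/-- **ROW 1 AT THE CHOSEN REALISING q-IDELE, idele-hypothesis-free** (`Cor312Prov.exists_realising_qIdeles_pilotDataOfK`, [IUTchI] Ex. 3.2 (iv)):
the POS door at `j = 2` at every bad place ⟹ `StarBelow D (chosen tq) 2`. [cite: Mochizuki2012, IUTchI Ex. 3.2 (iv) p. 71] [claim: Mochizuki2012, status: disputed] -/
theorem starBelow_two_chosen_of_posDoor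
    (hdoor : ∀ (pp : Nat.Primes) (w : (thetaIndex (pilotDataOfK D K)).Fibre (.inr pp)),
      haveI : Fact (pp : ℕ).Prime := ⟨pp.2⟩
      placeOf (pilotDataOfK D K) pp.1 w ∈ (pilotDataOfK D K).S →
        ∃ P : ℕ, (pilotDataOfK D K).qPilot (placeOf (pilotDataOfK D K) pp.1 w) = P ∧
          PosDoor (pp : ℕ) (absRamificationIdx (pp : ℕ) (kOf (pilotDataOfK D K) pp.1 w)) P 2) :
    StarBelow D (exists_realising_qIdeles_pilotDataOfK D).choose 2 :=
  starBelow_two_of_posDoor D (exists_realising_qIdeles_pilotDataOfK D).choose (exists_realising_qIdeles_pilotDataOfK D).choose_spec.1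
    (exists_realising_qIdeles_pilotDataOfK D).choose_spec.2.2 hdoor

end Genuine

/-! ## §3. Integer rows by `decide`: the `j = 2` frontier at the k3 packets, and the `p = 3` rider in integer currency -/

/-- **THE `j = 2` HEX FRONTIER on the two smallest genuine local types** (`p = 7`, `e(v|7) = 1`, `e_w = l ∈ {11, 13}`, `P_w = k`): POS for
`k ≤ 2` (resp. `k ≤ 3`), neither door for `3 ≤ k ≤ 7` (resp. `4 ≤ k ≤ 8`) — OPEN —, NEG from `k = 8` (resp. `k = 9`) on. Row 1 is two-sided on the
genuine HEX rows; none of this involves `e_w = 1`. [folklore] -/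
theorem k3_hex_j2_frontier :
    PosDoor 7 11 1 2 ∧ PosDoor 7 11 2 2 ∧ ¬ PosDoor 7 11 3 2 ∧ ¬ NegDoor 7 11 3 2 ∧ ¬ NegDoor 7 11 7 2 ∧ NegDoor 7 11 8 2 ∧
    PosDoor 7 13 1 2 ∧ PosDoor 7 13 3 2 ∧ ¬ PosDoor 7 13 4 2 ∧ ¬ NegDoor 7 13 4 2 ∧ ¬ NegDoor 7 13 8 2 ∧ NegDoor 7 13 9 2 := by
  unfold PosDoor NegDoor
  decide

/-- **G-HEX binding rows are POS at `j = 2`** (WINDOW-TABLE v1 / I06STAR-COLUMNS block (1), `p = 7`, `e_w = l·e(v|7)`, `P_w = k·e(v|7)`):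
`k4-l23-ev1` (`16 + ⌈23/5⌉ = 21 ≤ 27`), `k1-l11-ev1`, `k2-l13-ev1`, `k12-l211-ev5` (`e_w = 1055`, `P_w = 60`), `k13-l223-ev15`, `k14-l239-ev15` — row 1
holds at these packets (the lead's «lamSeven 256/256»), including packets where R-W's verdict is REFUTED-ED: by law (L2) this certifies
«`StarBelow 2 ⊬ S_H`» there, consistent with the row's «no claim at `j ≥ 3`». [folklore] -/
theorem k3_ghex_binding_pos :
    PosDoor 7 23 4 2 ∧ PosDoor 7 11 1 2 ∧ PosDoor 7 13 2 2 ∧ PosDoor 7 1055 60 2 ∧ PosDoor 7 3345 195 2 ∧ PosDoor 7 3585 210 2 := by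
  unfold PosDoor
  decide

/-- **The `l = 5` strip at `e(v|7) = 1`** (`p = 7`, `e_w = 5` TAME, `P_w = k`): the POS door holds only at `k = 1` (S-X75's shape `PosDoor 7 5 1 2`);
at `k = 2` neither integer door fires — the cell is decided NEG by the exact TAME iff (`3·2 > 5 − 1`, `not_starBelow_two_of_tame_lt`), not by the
deep NEG door, which is silent on tame rows. [folklore] -/
theorem k3_hexstrip_l5 : PosDoor 7 5 1 2 ∧ ¬ PosDoor 7 5 2 2 ∧ ¬ NegDoor 7 5 2 2 ∧ ((5 : ℤ) - 1 < 3 * 2) := by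
  unfold PosDoor NegDoor
  decide

/-- **The `p = 3` rider of p458420 in integer currency**: `⌈e/(3−2)⌉ = e`, so `PosDoor 3 e P 2 ⟺ 4P + e ≤ e + P ⟺ P = 0` — at every 3-adic
bad place (any ramification `e`, any `P_w ≥ 1`) the POS-door FORM of row 1 («`h(w,2) ≤ κ⁻(w)`», `κ⁻ ≡ 0` over `3`) is shut; the data cell itself is
not thereby decided (sharp radius). [claim: Mochizuki2012, status: disputed] -/
theorem not_posDoor_three_two {e P : ℕ} (hP : 1 ≤ P) : ¬ PosDoor 3 e P 2 := by
  unfold PosDoor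
  omega

/-! ## §4. The lattice face `RH.LabelCutJ2.HStar S P ρ qK` is bitten by the region member on the honest bed -/

section Lattice

variable {T : ThetaIndex} (S : LatticeSituation T) (P : Cor312.Setting S.toSituation)
  (ρ : (∀ v : T.V, v ∈ T.Vbad → Set (S.L.StarPacket v)) → ∀ (j : T.Label) (vQ : T.VQ), Set (S.L.Packet j vQ))
  (qK : ∀ v : T.V, v ∈ T.Vbad → Set (S.L.StarPacket v))

/-- **k2T ON THE LATTICE FACE — BITTEN**: abc-iut-rh-typ-1's `RH.LabelCutJ2.HStar S P ρ qK` (I06⋆ at the labels `j ≤ 2`) is FALSE on the honest bed: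
q-pin `QPinned`, RP-I05b `HInd3Theta`, monotone log-volume, and at ONE packet `v_ℚ` the (Ind3)-Θ-region at the label `2` admissible with the exact
scaling `logvol(thetaRegion3 2 v_ℚ) = 2²·qLocal 2 v_ℚ` and `qLocal 2 v_ℚ < 0` (`l⋇ ≥ 2`). One line: the decl's `j = 2` cell is the cell excluded by
p458420's `RHLabelCutJ2K2.labelTwo_shellOrbit_false_of_honest` — the region member of the family that refuted I06⋆ (`EvalHonestCeiling.i06_false_of_honest`)
bites the label cut unchanged, since it reads only the `j = 2` cell. [folklore] -/
theorem not_hStar_of_honest (hl : 2 ≤ T.lstar) (hq : QPinned S P ρ qK) (hA : CandInternal2.HInd3Theta S P ρ)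
    (hmono : LogvolMono P) (vQ : T.VQ)
    (hθ : (S.D P.n).Adm _ vQ (P.thetaRegion3 (Setting.labelSucc ⟨1, hl⟩) vQ))
    (hscaled : (S.D P.n).logvol _ vQ (P.thetaRegion3 (Setting.labelSucc ⟨1, hl⟩) vQ) =
      (((1 : ℕ) + 1 : ℕ) : ℝ) ^ 2 * P.qLocal (Setting.labelSucc ⟨1, hl⟩) vQ)
    (hneg : P.qLocal (Setting.labelSucc ⟨1, hl⟩) vQ < 0) :
    ¬ RH.LabelCutJ2.HStar S P ρ qK := fun h =>
  RHLabelCutJ2K2.labelTwo_shellOrbit_false_of_honest S P ρ qK hl hq hA hmono vQ hθ hscaled hneg (h ⟨1, hl⟩ vQ (by norm_num))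

/-- … whereas the FULL I06⋆ `HQShellOrbitStar` gives the lattice face (abc-iut-rh-typ-1's `hStar_of_star`, restated for the census: the label cut is
WEAKER than I06⋆, and the honest bed kills both through the same cell). [folklore] -/
theorem not_hQShellOrbitStar_of_honest (hl : 2 ≤ T.lstar) (hq : QPinned S P ρ qK) (hA : CandInternal2.HInd3Theta S P ρ)
    (hmono : LogvolMono P) (vQ : T.VQ)
    (hθ : (S.D P.n).Adm _ vQ (P.thetaRegion3 (Setting.labelSucc ⟨1, hl⟩) vQ))
    (hscaled : (S.D P.n).logvol _ vQ (P.thetaRegion3 (Setting.labelSucc ⟨1, hl⟩) vQ) =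
      (((1 : ℕ) + 1 : ℕ) : ℝ) ^ 2 * P.qLocal (Setting.labelSucc ⟨1, hl⟩) vQ)
    (hneg : P.qLocal (Setting.labelSucc ⟨1, hl⟩) vQ < 0) :
    ¬ CandInternal11Gap.HQShellOrbitStar S P ρ qK := fun h =>
  not_hStar_of_honest S P ρ qK hl hq hA hmono vQ hθ hscaled hneg (RH.LabelCutJ2.hStar_of_star S P ρ qK h)

end Lattice

end Summit.ABC.IUTFork.Repair.RHLabelCutJ2Genuine

end
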